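import Summits.HodgeConjecture.CorCM.MumfordTateRankEllipticProducts
import HarnessLib

/-!
# Abelian surfaces by Mumford–Tate rank: the shape attached to each value `t ∈ {2, 3, 4, 5, 7, 11}`

Sub-problem `CorCM` of `HodgeConjecture` (cell `pub-hodgecm2`, count-neutral Mumford–Tate-rank lane of seat `b27`; theorems only,
no new definition, no named fact; nothing here uses or asserts `HC_CM`).  Read backwards, the classification of
`CorCM/MumfordTateRankSimpleSurfaces` (simple: `t ∈ {3,4,7,11}` by endomorphism type), `CorCM/MumfordTateRankSurfaces`
(non-simple ⟹ `X ∼ E₁ × E₂`) and `CorCM/MumfordTateRankEllipticProducts` (the `E₁ × E₂` table) determines the isogeny shape of a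
complex abelian surface `X` from `t = dim MT(H¹X)`:

* `t = 2` ⟹ `X ∼ E₁ × E₂` with `E₁ ∼ E₂` of CM type (`X ∼ E²`, `E` CM);
* `t = 3` ⟹ `X` simple of CM type, or `X ∼ E₁ × E₂` with `E₁, E₂` CM and not isogenous;
* `t = 4` ⟹ `X` simple with quaternionic multiplication (`dim_ℚ End⁰X = 4`, non-commutative), or `X ∼ E₁ × E₂` with `E₁ ∼ E₂` not CM;
* `t = 5` ⟹ `X ∼ E₁ × E₂` with exactly one CM factor;
* `t = 7` ⟹ `X` simple with `dim_ℚ End⁰X ≤ 2` (real multiplication, or the `End⁰ = ℚ` case that `CorCM/MumfordTateRankSevenTypeThreeFactor`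
  excludes once landed), or `X ∼ E₁ × E₂` with `E₁ ≁ E₂` both not CM;
* `t = 11` ⟹ `X` simple with `End⁰X = ℚ` (`CorCM/MumfordTateRankSurfaces`).

## References
* [MoonenZarhin1999LowDim] B. Moonen, Yu. G. Zarhin, *Hodge classes on abelian varieties of low dimension*, Math. Ann. 315 (1999), §2.
-/

noncomputable section

namespace Summit.HodgeConjecture.CorCM

open scoped TensorProduct
open CategoryTheory CategoryTheory.Limits Module
open Literature.AlgebraicGeometry.Motives
open Literature.AlgebraicGeometry.Motives.AbelianVariety
open Literature.AlgebraicGeometry.Motives.HodgeStructure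
open Literature.AlgebraicGeometry.HodgeTheory
open Literature.AlgebraicGeometry.Milne1999 (IsOfCMType)

variable [HodgeTensorFacts.{0, 0}] {X : AbelianVariety ℂ} {n : ℕ}

/-- **`t = 2` ⟹ `X ∼ E₁ × E₂` with `E₁ ∼ E₂` of CM type.** [cite: MoonenZarhin1999LowDim, §2] -/
theorem surface_shape_of_mtRank_eq_two (hX : IsSmoothProjective n X.X) (hX2 : X.dim = 2)
    (ht : haveI := BettiUniverse.finite hX 1
      (BettiUniverse.hodge exists_isReal_hodgeModel_holds hX 1).mtRank = 2) :
    ∃ E₁ E₂ : AbelianVariety ℂ, E₁.dim = 1 ∧ E₂.dim = 1 ∧ IsOfCMType E₁ ∧ IsOfCMType E₂ ∧ IsIsogenous E₁ E₂ ∧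
      IsIsogenous X (E₁.prod E₂) := by
  by_cases hs : X.IsSimple
  · rcases mtRank_hodge_one_mem_of_isSimple_surface hX hs hX2 with h | h | h | h <;> omega
  · obtain ⟨E₁, E₂, h1, h2, hXE⟩ := exists_isIsogenous_prod_of_not_isSimple_surface hX2 hs
    rcases mtRank_hodge_one_of_isIsogenous_prod_curves hX h1 h2 hXE with
      ⟨c1, c2, hi, -⟩ | ⟨-, -, -, h⟩ | ⟨-, -, -, h⟩ | ⟨-, h⟩ | ⟨-, -, -, h⟩
    · exact ⟨E₁, E₂, h1, h2, c1, c2, hi, hXE⟩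
    all_goals omega

/-- **`t = 3` ⟹ `X` simple of CM type, or `X ∼ E₁ × E₂` with two non-isogenous CM curves.** [cite: MoonenZarhin1999LowDim, §2] -/
theorem surface_shape_of_mtRank_eq_three (hX : IsSmoothProjective n X.X) (hX2 : X.dim = 2)
    (ht : haveI := BettiUniverse.finite hX 1
      (BettiUniverse.hodge exists_isReal_hodgeModel_holds hX 1).mtRank = 3) :
    (X.IsSimple ∧ IsOfCMType X) ∨
      ∃ E₁ E₂ : AbelianVariety ℂ, E₁.dim = 1 ∧ E₂.dim = 1 ∧ IsOfCMType E₁ ∧ IsOfCMType E₂ ∧ ¬ IsIsogenous E₁ E₂ ∧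
        IsIsogenous X (E₁.prod E₂) := by
  by_cases hs : X.IsSimple
  · exact Or.inl ⟨hs, (isOfCMType_iff_mtRank_hodge_one_eq_three_of_isSimple_surface hX hs hX2).2 ht⟩
  · obtain ⟨E₁, E₂, h1, h2, hXE⟩ := exists_isIsogenous_prod_of_not_isSimple_surface hX2 hs
    rcases mtRank_hodge_one_of_isIsogenous_prod_curves hX h1 h2 hXE with
      ⟨-, -, -, h⟩ | ⟨c1, c2, hni, -⟩ | ⟨-, -, -, h⟩ | ⟨-, h⟩ | ⟨-, -, -, h⟩
    · omega
    · exact Or.inr ⟨E₁, E₂, h1, h2, c1, c2, hni, hXE⟩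
    all_goals omega

/-- **`t = 4` ⟹ `X` simple with quaternionic multiplication, or `X ∼ E₁ × E₂` with `E₁ ∼ E₂` not of CM type (`X ∼ E²`).**
[cite: MoonenZarhin1999LowDim, §2] -/
theorem surface_shape_of_mtRank_eq_four (hX : IsSmoothProjective n X.X) (hX2 : X.dim = 2)
    (ht : haveI := BettiUniverse.finite hX 1
      (BettiUniverse.hodge exists_isReal_hodgeModel_holds hX 1).mtRank = 4) :
    (X.IsSimple ∧ Module.finrank ℚ X.endAlgebra = 4 ∧ ∃ x y : X.endAlgebra, x * y ≠ y * x) ∨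
      ∃ E₁ E₂ : AbelianVariety ℂ, E₁.dim = 1 ∧ E₂.dim = 1 ∧ ¬ IsOfCMType E₁ ∧ ¬ IsOfCMType E₂ ∧ IsIsogenous E₁ E₂ ∧
        IsIsogenous X (E₁.prod E₂) := by
  by_cases hs : X.IsSimple
  · rcases mtRank_hodge_one_of_isSimple_surface hX hs hX2 with ⟨-, h | h⟩ | ⟨-, h⟩ | ⟨-, -, -, h⟩ | ⟨h4, hnc, -⟩
    any_goals omega
    exact Or.inl ⟨hs, h4, hnc⟩
  · obtain ⟨E₁, E₂, h1, h2, hXE⟩ := exists_isIsogenous_prod_of_not_isSimple_surface hX2 hs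
    rcases mtRank_hodge_one_of_isIsogenous_prod_curves hX h1 h2 hXE with
      ⟨-, -, -, h⟩ | ⟨-, -, -, h⟩ | ⟨c1, c2, hi, -⟩ | ⟨-, h⟩ | ⟨-, -, -, h⟩
    any_goals omega
    exact Or.inr ⟨E₁, E₂, h1, h2, c1, c2, hi, hXE⟩

/-- **`t = 5` ⟹ `X ∼ E₁ × E₂` with exactly one factor of CM type.** [cite: MoonenZarhin1999LowDim, §2 and §3 Thm. (3.2)(2)] -/
theorem surface_shape_of_mtRank_eq_five (hX : IsSmoothProjective n X.X) (hX2 : X.dim = 2)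
    (ht : haveI := BettiUniverse.finite hX 1
      (BettiUniverse.hodge exists_isReal_hodgeModel_holds hX 1).mtRank = 5) :
    ∃ E₁ E₂ : AbelianVariety ℂ, E₁.dim = 1 ∧ E₂.dim = 1 ∧ ¬ (IsOfCMType E₁ ↔ IsOfCMType E₂) ∧ IsIsogenous X (E₁.prod E₂) := by
  by_cases hs : X.IsSimple
  · rcases mtRank_hodge_one_mem_of_isSimple_surface hX hs hX2 with h | h | h | h <;> omega
  · obtain ⟨E₁, E₂, h1, h2, hXE⟩ := exists_isIsogenous_prod_of_not_isSimple_surface hX2 hs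
    rcases mtRank_hodge_one_of_isIsogenous_prod_curves hX h1 h2 hXE with
      ⟨-, -, -, h⟩ | ⟨-, -, -, h⟩ | ⟨-, -, -, h⟩ | ⟨hmix, -⟩ | ⟨-, -, -, h⟩
    any_goals omega
    exact ⟨E₁, E₂, h1, h2, hmix, hXE⟩

/-- **`t = 7` ⟹ `X` simple with `dim_ℚ End⁰X ≤ 2` (real multiplication — or the `End⁰ = ℚ` case, excluded by the type-III chain), or
`X ∼ E₁ × E₂` with two non-isogenous non-CM curves.** [cite: MoonenZarhin1999LowDim, §2 and §3 (3.1)] -/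
theorem surface_shape_of_mtRank_eq_seven (hX : IsSmoothProjective n X.X) (hX2 : X.dim = 2)
    (ht : haveI := BettiUniverse.finite hX 1
      (BettiUniverse.hodge exists_isReal_hodgeModel_holds hX 1).mtRank = 7) :
    (X.IsSimple ∧ Module.finrank ℚ X.endAlgebra ≤ 2) ∨
      ∃ E₁ E₂ : AbelianVariety ℂ, E₁.dim = 1 ∧ E₂.dim = 1 ∧ ¬ IsOfCMType E₁ ∧ ¬ IsOfCMType E₂ ∧ ¬ IsIsogenous E₁ E₂ ∧
        IsIsogenous X (E₁.prod E₂) := by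
  by_cases hs : X.IsSimple
  · rcases mtRank_hodge_one_of_isSimple_surface hX hs hX2 with ⟨h1, -⟩ | ⟨h2, -⟩ | ⟨-, -, -, h⟩ | ⟨-, -, h⟩
    · exact Or.inl ⟨hs, by omega⟩
    · exact Or.inl ⟨hs, by omega⟩
    all_goals omega
  · obtain ⟨E₁, E₂, h1, h2, hXE⟩ := exists_isIsogenous_prod_of_not_isSimple_surface hX2 hs
    rcases mtRank_hodge_one_of_isIsogenous_prod_curves hX h1 h2 hXE with
      ⟨-, -, -, h⟩ | ⟨-, -, -, h⟩ | ⟨-, -, -, h⟩ | ⟨-, h⟩ | ⟨c1, c2, hni, -⟩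
    any_goals omega
    exact Or.inr ⟨E₁, E₂, h1, h2, c1, c2, hni, hXE⟩

end Summit.HodgeConjecture.CorCM

end
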